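import Summits.Ventures.Crystal3D.Bulk.CapBoxSearch
import HarnessLib

/-!
# The tensor-Bernstein check, end to end: `checkPos3 = true ⇒ P ≥ 0` on the box where Gram `≥ 0`

Venture `Crystal3D` (cell `pub-crystal3d`, phase 2; seat typer-bulk). The root of the search of
`CapBoxSearch.lean`: conversion of the power-form tensor on the box (`val3Q_toBern3`), outward integerisation
(`val3N_toNat3_le`, `le_val3N_toNat3Up`), the Gram side condition (`eval3_gramQ3`), and the single Boolean
`checkPos3 P n box NB NGB fuel` with its soundness theorem `nonneg_of_checkPos3`:
a `true` run proves `eval3 P u v t ≥ 0` for all real `(u, v, t)` in the box with `1 + 2uvt - u² - v² - t² ≥ 0`.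
HONEST FRAMING: bookkeeping [folklore]; the run itself is done elsewhere (`decide` or `native_decide`).
-/

open Finset

namespace Summit.Ventures.Crystal3D.CapCut.Bern

variable {α : Type}

/-! ### The check -/

/-- Smallest entry of a rational tensor (`≤ 0` by construction: the fold starts at `0`). [folklore] -/
def minEntry3 (B : QT3) : ℚ := (B.map fun sl => (sl.map fun ln => ln.foldr min 0).foldr min 0).foldr min 0

/-- The complete check for «`P ≥ 0` on `[lo₀,hi₀]×[lo₁,hi₁]×[lo₂,hi₂] ∩ {Gram ≥ 0}`»: shape and box sanity,
conversion, integerisation at scales `2^NB` / `2^NGB` with offsets chosen from the smallest entries, no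
truncation, and the branch and bound with depth `≤ fuel`. [folklore] -/
def checkPos3 (P : QT3) (n : ℕ) (lo0 hi0 lo1 hi1 lo2 hi2 : ℚ) (NB NGB fuel : ℕ) : Bool :=
  let B := toBern3 lo0 hi0 lo1 hi1 lo2 hi2 P
  let N : ℕ := 2 ^ NB
  let M : ℕ := (-(⌊(N : ℚ) * minEntry3 B⌋)).toNat
  let G := toBern3 lo0 hi0 lo1 hi1 lo2 hi2 gramQ3
  let NG : ℕ := 2 ^ NGB
  let MG : ℕ := (-(⌊(NG : ℚ) * minEntry3 G⌋)).toNat + 1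
  shapeOK3 n P && decide (lo0 < hi0) && decide (lo1 < hi1) && decide (lo2 < hi2) &&
    offsetOK N M B && offsetOKUp NG MG G &&
      bnb n 2 fuel 0 (toNat3 N M B) M (toNat3Up NG MG G) MG

/-! ### Shapes through the conversion -/

/-- Members of `hornerAux`. [folklore] -/
theorem hornerAux_forall (add : α → α → α) (smul : ℚ → α → α) (Q : α → Prop)
    (hadd : ∀ a b, Q a → Q b → Q (add a b)) (hsmul : ∀ (c : ℚ) a, Q a → Q (smul c a))
    (lo hi : ℚ) (c : α) (hc : Q c) (m1 : ℕ) :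
    ∀ (rs : List α) (a : ℕ) (prev : α), Q prev → (∀ r ∈ rs, Q r) →
      ∀ w ∈ hornerAux add smul lo hi c m1 a prev rs, Q w := by
  intro rs
  induction rs with
  | nil =>
    intro a prev hp _ w hw
    simp only [hornerAux, List.mem_singleton] at hw
    subst hw; exact hadd _ _ (hsmul _ _ hp) hc
  | cons r rs ih =>
    intro a prev hp hrs w hw
    simp only [hornerAux, List.mem_cons] at hw
    rcases hw with rfl | hw
    · exact hadd _ _ (hadd _ _ (hsmul _ _ hp) (hsmul _ _ (hrs r (by simp)))) hc
    · exact ih (a + 1) r (hrs r (by simp)) (fun r' hr' => hrs r' (by simp [hr'])) w hw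

/-- Members of `toBern`. [folklore] -/
theorem toBern_forall (add : α → α → α) (smul : ℚ → α → α) (Q : α → Prop)
    (hadd : ∀ a b, Q a → Q b → Q (add a b)) (hsmul : ∀ (c : ℚ) a, Q a → Q (smul c a)) (lo hi : ℚ) :
    ∀ cs : List α, (∀ c ∈ cs, Q c) → ∀ w ∈ toBern add smul lo hi cs, Q w := by
  intro cs
  induction cs with
  | nil => intro _ w hw; simp [toBern] at hw
  | cons c cs ih =>
    intro hcs w hw
    cases cs with
    | nil => simp only [toBern, List.mem_singleton] at hw; subst hw; exact hcs _ (by simp)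
    | cons c' cs' =>
      simp only [toBern] at hw
      have hb : ∀ x ∈ toBern add smul lo hi (c' :: cs'), Q x := ih (fun x hx => hcs x (by simp [hx]))
      -- hornerStep
      generalize hB : toBern add smul lo hi (c' :: cs') = b at hw hb
      cases b with
      | nil => simp only [hornerStep, List.mem_singleton] at hw; subst hw; exact hcs _ (by simp)
      | cons r rs =>
        simp only [hornerStep, List.mem_cons] at hw
        rcases hw with rfl | hw
        · exact hadd _ _ (hsmul _ _ (hb r (by simp))) (hcs _ (by simp))
        · exact hornerAux_forall add smul Q hadd hsmul lo hi c (hcs _ (by simp)) _ rs 1 r (hb r (by simp))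
            (fun x hx => hb x (by simp [hx])) w hw

/-- Rational line/slice shape predicates. [folklore] -/
def PQ1 (n : ℕ) (ln : QT1) : Prop := ln.length = n + 1
/-- Rational slice shape predicate. [folklore] -/
def PQ2 (n : ℕ) (sl : QT2) : Prop := sl.length = n + 1 ∧ ∀ ln ∈ sl, PQ1 n ln

/-- `qadd1` preserves the line length. [folklore] -/
theorem qadd1_PQ1 (n : ℕ) (a b : QT1) (ha : PQ1 n a) (hb : PQ1 n b) : PQ1 n (qadd1 a b) :=
  lzip_length _ a b _ ha hb
/-- `qsmul1` preserves the line length. [folklore] -/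
theorem qsmul1_PQ1 (n : ℕ) (c : ℚ) (a : QT1) (ha : PQ1 n a) : PQ1 n (qsmul1 c a) := by
  unfold PQ1 qsmul1 at *; rw [List.length_map, ha]
/-- `qadd2` preserves the slice shape. [folklore] -/
theorem qadd2_PQ2 (n : ℕ) (a b : QT2) (ha : PQ2 n a) (hb : PQ2 n b) : PQ2 n (qadd2 a b) :=
  ⟨lzip_length _ a b _ ha.1 hb.1, lzip_forall qadd1 (PQ1 n) (qadd1_PQ1 n) a b ha.2 hb.2⟩
/-- `qsmul2` preserves the slice shape. [folklore] -/
theorem qsmul2_PQ2 (n : ℕ) (c : ℚ) (a : QT2) (ha : PQ2 n a) : PQ2 n (qsmul2 c a) := by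
  refine ⟨by unfold qsmul2; rw [List.length_map, ha.1], fun ln hln => ?_⟩
  unfold qsmul2 at hln; rw [List.mem_map] at hln
  obtain ⟨ln', h', rfl⟩ := hln
  exact qsmul1_PQ1 n c ln' (ha.2 ln' h')

/-- The conversion preserves the shape. [folklore] -/
theorem shape3_toBern3 (n : ℕ) (lo0 hi0 lo1 hi1 lo2 hi2 : ℚ) (P : QT3) (hP : Shape3 n P) :
    Shape3 n (toBern3 lo0 hi0 lo1 hi1 lo2 hi2 P) := by
  unfold toBern3
  -- the mapped slices have shape PQ2
  have hX : ∀ sl ∈ P.map (fun sl => toBern qadd1 qsmul1 lo1 hi1 (sl.map fun ln => toBern (· + ·) (· * ·) lo2 hi2 ln)),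
      PQ2 n sl := by
    intro sl hsl
    rw [List.mem_map] at hsl
    obtain ⟨sl', hsl', rfl⟩ := hsl
    refine ⟨by rw [toBern_length, List.length_map]; exact (hP.2 sl' hsl').1, ?_⟩
    refine toBern_forall qadd1 qsmul1 (PQ1 n) (qadd1_PQ1 n) (qsmul1_PQ1 n) lo1 hi1 _ ?_
    intro ln hln
    rw [List.mem_map] at hln
    obtain ⟨ln', hln', rfl⟩ := hln
    unfold PQ1; rw [toBern_length]; exact (hP.2 sl' hsl').2 ln' hln'
  refine ⟨by rw [toBern_length, List.length_map, hP.1], ?_⟩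
  exact toBern_forall qadd2 qsmul2 (PQ2 n) (qadd2_PQ2 n) (qsmul2_PQ2 n) lo0 hi0 _ hX

/-- Triple maps preserve the shape. [folklore] -/
theorem shape3_map3 {β γ : Type} (n : ℕ) (f : β → γ) (B : List (List (List β))) (hB : Shape3 n B) :
    Shape3 n (B.map fun sl => sl.map fun ln => ln.map f) := by
  refine ⟨by rw [List.length_map, hB.1], fun sl hsl => ?_⟩
  rw [List.mem_map] at hsl
  obtain ⟨sl', hsl', rfl⟩ := hsl
  refine ⟨by rw [List.length_map]; exact (hB.2 sl' hsl').1, fun ln hln => ?_⟩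
  rw [List.mem_map] at hln
  obtain ⟨ln', hln', rfl⟩ := hln
  rw [List.length_map]; exact (hB.2 sl' hsl').2 ln' hln'

/-! ### The root: conversion and integerisation -/

/-- **The conversion is sound in three variables**: the Bernstein value of the converted tensor at
`(s₁,s₂,s₃)` is the power-form value at the corresponding point of the box. [folklore] -/
theorem val3Q_toBern3 (n : ℕ) (P : QT3) (hP : Shape3 n P) (lo0 hi0 lo1 hi1 lo2 hi2 : ℚ) (s1 s2 s3 : ℝ) :
    val3Q n (toBern3 lo0 hi0 lo1 hi1 lo2 hi2 P) s1 s2 s3 =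
      eval3 P ((lo0 : ℝ) * (1 - s1) + hi0 * s1) ((lo1 : ℝ) * (1 - s2) + hi1 * s2) ((lo2 : ℝ) * (1 - s3) + hi2 * s3) := by
  unfold val3Q toBern3 eval3
  set X := P.map (fun sl => toBern qadd1 qsmul1 lo1 hi1 (sl.map fun ln => toBern (· + ·) (· * ·) lo2 hi2 ln)) with hX
  have hlen : X.length - 1 = n := by rw [hX, List.length_map, hP.1]; rfl
  have h1 := bvF_toBern (linQ2 n s2 s3) lo0 hi0 s1 X
  rw [hlen] at h1
  rw [h1, hX, pvF_map]
  refine pvF_congr_mem P _ fun sl hsl => ?_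
  simp only [Function.comp]
  have hlen2 : (sl.map fun ln => toBern (· + ·) (· * ·) lo2 hi2 ln).length - 1 = n := by
    rw [List.length_map, (hP.2 sl hsl).1]; rfl
  have h2 := bvF_toBern (linQ1 n s3) lo1 hi1 s2 (sl.map fun ln => toBern (· + ·) (· * ·) lo2 hi2 ln)
  rw [hlen2] at h2
  rw [h2, pvF_map]
  refine pvF_congr_mem sl _ fun ln hln => ?_
  simp only [Function.comp]
  have hlen3 : ln.length - 1 = n := by rw [(hP.2 sl hsl).2 ln hln]; rfl
  have h3 := bvF_toBern linQ0 lo2 hi2 s3 ln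
  rw [hlen3] at h3
  exact h3

/-- Lower integerisation is an outward rounding: `val3N (toNat3 N M B) ≤ N · val3Q B + M` on the cube.
[folklore] -/
theorem val3N_toNat3_le (n : ℕ) (B : QT3) (hB : Shape3 n B) (N M : ℕ) (hoff : offsetOK N M B = true)
    {s1 s2 s3 : ℝ} (h10 : 0 ≤ s1) (h11 : s1 ≤ 1) (h20 : 0 ≤ s2) (h21 : s2 ≤ 1) (h30 : 0 ≤ s3) (h31 : s3 ≤ 1) :
    val3N n (toNat3 N M B) s1 s2 s3 ≤ (N : ℝ) * val3Q n B s1 s2 s3 + M := by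
  simp only [offsetOK, List.all_eq_true, decide_eq_true_eq] at hoff
  unfold val3N val3Q toNat3
  refine bvF_map_le_affine _ (N : ℝ) (M : ℝ) n h10 h11 B hB.1 fun sl hsl => ?_
  refine bvF_map_le_affine _ (N : ℝ) (M : ℝ) n h20 h21 sl (hB.2 sl hsl).1 fun ln hln => ?_
  refine bvF_map_le_affine _ (N : ℝ) (M : ℝ) n h30 h31 ln ((hB.2 sl hsl).2 ln hln) fun q hq => ?_
  have h0 := hoff sl hsl ln hln q hq
  have hc : (((⌊(N : ℚ) * q⌋ + M).toNat : ℕ) : ℝ) = ((⌊(N : ℚ) * q⌋ + M : ℤ) : ℝ) := by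
    exact_mod_cast Int.toNat_of_nonneg h0
  rw [hc]; push_cast
  have hf : ((⌊(N : ℚ) * q⌋ : ℤ) : ℝ) ≤ (N : ℝ) * (q : ℝ) := by
    have := Int.floor_le ((N : ℚ) * q)
    exact_mod_cast this
  linarith

/-- Upper integerisation is an outward rounding: `N · val3Q G + M ≤ val3N (toNat3Up N M G)` on the cube.
[folklore] -/
theorem le_val3N_toNat3Up (n : ℕ) (B : QT3) (hB : Shape3 n B) (N M : ℕ) (hoff : offsetOKUp N M B = true)
    {s1 s2 s3 : ℝ} (h10 : 0 ≤ s1) (h11 : s1 ≤ 1) (h20 : 0 ≤ s2) (h21 : s2 ≤ 1) (h30 : 0 ≤ s3) (h31 : s3 ≤ 1) :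
    (N : ℝ) * val3Q n B s1 s2 s3 + M ≤ val3N n (toNat3Up N M B) s1 s2 s3 := by
  simp only [offsetOKUp, List.all_eq_true, decide_eq_true_eq] at hoff
  unfold val3N val3Q toNat3Up
  refine le_bvF_map_affine _ (N : ℝ) (M : ℝ) n h10 h11 B hB.1 fun sl hsl => ?_
  refine le_bvF_map_affine _ (N : ℝ) (M : ℝ) n h20 h21 sl (hB.2 sl hsl).1 fun ln hln => ?_
  refine le_bvF_map_affine _ (N : ℝ) (M : ℝ) n h30 h31 ln ((hB.2 sl hsl).2 ln hln) fun q hq => ?_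
  have h0 := hoff sl hsl ln hln q hq
  have hc : (((⌈(N : ℚ) * q⌉ + M).toNat : ℕ) : ℝ) = ((⌈(N : ℚ) * q⌉ + M : ℤ) : ℝ) := by
    exact_mod_cast Int.toNat_of_nonneg h0
  rw [hc]; push_cast
  have hf : (N : ℝ) * (q : ℝ) ≤ ((⌈(N : ℚ) * q⌉ : ℤ) : ℝ) := by
    have := Int.le_ceil ((N : ℚ) * q)
    exact_mod_cast this
  linarith

/-- The Gram tensor evaluates to the Gram polynomial. [folklore] -/
theorem eval3_gramQ3 (u v t : ℝ) : eval3 gramQ3 u v t = 1 + 2 * u * v * t - u ^ 2 - v ^ 2 - t ^ 2 := by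
  simp [eval3, gramQ3, pvF]; ring

/-- The Gram tensor has shape `3³`. [folklore] -/
theorem shape3_gramQ3 : Shape3 2 gramQ3 := shape3_of_shapeOK3 2 gramQ3 (by decide)

/-! ### End to end -/

/-- **Soundness of the check.** If `checkPos3 P n lo₀ hi₀ lo₁ hi₁ lo₂ hi₂ NB NGB fuel = true` then
`eval3 P u v t ≥ 0` for all real `u ∈ [lo₀,hi₀]`, `v ∈ [lo₁,hi₁]`, `t ∈ [lo₂,hi₂]` with
`1 + 2uvt - u² - v² - t² ≥ 0`. [folklore] -/
theorem nonneg_of_checkPos3 (P : QT3) (n : ℕ) (lo0 hi0 lo1 hi1 lo2 hi2 : ℚ) (NB NGB fuel : ℕ)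
    (h : checkPos3 P n lo0 hi0 lo1 hi1 lo2 hi2 NB NGB fuel = true) :
    ∀ u v t : ℝ, (lo0 : ℝ) ≤ u → u ≤ hi0 → (lo1 : ℝ) ≤ v → v ≤ hi1 → (lo2 : ℝ) ≤ t → t ≤ hi2 →
      0 ≤ 1 + 2 * u * v * t - u ^ 2 - v ^ 2 - t ^ 2 → 0 ≤ eval3 P u v t := by
  intro u v t hu0 hu1 hv0 hv1 ht0 ht1 hgram
  simp only [checkPos3, Bool.and_eq_true, decide_eq_true_eq] at h
  obtain ⟨⟨⟨⟨⟨⟨hshape, hl0⟩, hl1⟩, hl2⟩, hoff⟩, hoffG⟩, hbnb⟩ := h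
  set B := toBern3 lo0 hi0 lo1 hi1 lo2 hi2 P with hB
  set G := toBern3 lo0 hi0 lo1 hi1 lo2 hi2 gramQ3 with hG
  set N : ℕ := 2 ^ NB with hN
  set NG : ℕ := 2 ^ NGB with hNG
  set M : ℕ := (-(⌊(N : ℚ) * minEntry3 B⌋)).toNat with hM
  set MG : ℕ := (-(⌊(NG : ℚ) * minEntry3 G⌋)).toNat + 1 with hMG
  have hP : Shape3 n P := shape3_of_shapeOK3 n P hshape
  have hBs : Shape3 n B := shape3_toBern3 n _ _ _ _ _ _ P hP
  have hGs : Shape3 2 G := shape3_toBern3 2 _ _ _ _ _ _ gramQ3 shape3_gramQ3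
  have hYs : Shape3 n (toNat3 N M B) := shape3_map3 n _ B hBs
  have hHs : Shape3 2 (toNat3Up NG MG G) := shape3_map3 2 _ G hGs
  -- parameters in the unit cube
  have d0 : (0 : ℝ) < hi0 - lo0 := by
    have h' : ((lo0 : ℚ) : ℝ) < hi0 := by exact_mod_cast hl0
    linarith
  have d1 : (0 : ℝ) < hi1 - lo1 := by
    have h' : ((lo1 : ℚ) : ℝ) < hi1 := by exact_mod_cast hl1
    linarith
  have d2 : (0 : ℝ) < hi2 - lo2 := by
    have h' : ((lo2 : ℚ) : ℝ) < hi2 := by exact_mod_cast hl2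
    linarith
  set s1 := (u - lo0) / (hi0 - lo0) with hs1
  set s2 := (v - lo1) / (hi1 - lo1) with hs2
  set s3 := (t - lo2) / (hi2 - lo2) with hs3
  have h10 : 0 ≤ s1 := div_nonneg (by linarith) d0.le
  have h11 : s1 ≤ 1 := (div_le_one d0).2 (by linarith)
  have h20 : 0 ≤ s2 := div_nonneg (by linarith) d1.le
  have h21 : s2 ≤ 1 := (div_le_one d1).2 (by linarith)
  have h30 : 0 ≤ s3 := div_nonneg (by linarith) d2.le
  have h31 : s3 ≤ 1 := (div_le_one d2).2 (by linarith)
  have e0 : (lo0 : ℝ) * (1 - s1) + hi0 * s1 = u := by rw [hs1]; field_simp; ring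
  have e1 : (lo1 : ℝ) * (1 - s2) + hi1 * s2 = v := by rw [hs2]; field_simp; ring
  have e2 : (lo2 : ℝ) * (1 - s3) + hi2 * s3 = t := by rw [hs3]; field_simp; ring
  -- the Gram hypothesis gives the H-threshold at s
  have hHval : (MG : ℝ) ≤ val3N 2 (toNat3Up NG MG G) s1 s2 s3 := by
    have hup := le_val3N_toNat3Up 2 G hGs NG MG hoffG h10 h11 h20 h21 h30 h31
    rw [hG, val3Q_toBern3 2 gramQ3 shape3_gramQ3, e0, e1, e2, eval3_gramQ3] at hup
    have : (0 : ℝ) ≤ (NG : ℝ) * (1 + 2 * u * v * t - u ^ 2 - v ^ 2 - t ^ 2) := by positivity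
    linarith
  -- the search gives the Y-threshold
  have hY := bnb_sound n 2 fuel 0 _ M _ MG hbnb hYs hHs s1 s2 s3 h10 h11 h20 h21 h30 h31 hHval
  have hle := val3N_toNat3_le n B hBs N M hoff h10 h11 h20 h21 h30 h31
  rw [hB, val3Q_toBern3 n P hP, e0, e1, e2] at hle
  have hNpos : (0 : ℝ) < N := by rw [hN]; positivity
  have hNe : (0 : ℝ) ≤ (N : ℝ) * eval3 P u v t := by linarith
  by_contra hneg
  push Not at hneg
  have : (N : ℝ) * eval3 P u v t < 0 := mul_neg_of_pos_of_neg hNpos hneg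
  linarith

end Summit.Ventures.Crystal3D.CapCut.Bern
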